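import Literature.MathematicalPhysics.QuantumManyBody.CoulombEnergyPositivity
import Mathlib.Analysis.SpecialFunctions.Gaussian.GaussianIntegral
import Mathlib.MeasureTheory.Function.JacobianOneDim
import HarnessLib

/-!
# The Yukawa (resolvent) kernel by subordination: `∫₀^∞ e^{-μs} G_s(z) ds = e^{-√μ|z|}/(4π|z|)`

Topic `Literature/MathematicalPhysics/QuantumManyBody` (electrostatics groundwork for the charged
Bose gas, `JelliumBoseGas.foldyLaw` / [LiebSolovej2001, §3–4]: Yukawa cut-offs `Y_ν(x) =
e^{-ν|x|}/|x|` of the Coulomb kernel). The kernel of the resolvent `(-Δ + μ)⁻¹` on `ℝ³` is the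
Laplace transform of the heat kernel `G_s` of `Literature.Analysis.UnboundedOperators.HeatKernel`;
the case `μ = 0` is the tree's `BoseGas.integral_Ioi_heatKernel` (`PeriodicBoseGasCoulombFourier`).
Everything reduces to the classical integral

`∫₀^∞ s^{-3/2} e^{-a/s - bs} ds = √(π/a) e^{-2√(ab)}` (`a, b > 0`),

proved here in `ℝ≥0∞` (positive integrands, so no integrability bookkeeping) by two changes of
variables with Mathlib's one-dimensional Jacobian formula
`MeasureTheory.lintegral_image_eq_lintegral_abs_deriv_mul`:

* `lintegral_rpow_neg_three_halves_exp_eq` — inversion `s = (a/b)/t`: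
  `J_{3/2} = √(b/a) J_{1/2}` (`J_p = ∫₀^∞ s^{-p} e^{-a/s-bs} ds`);
* `lintegral_sqSubst_gaussian` — the completed square `u = √(bs) − √(a/s)`, a bijection
  `(0,∞) → ℝ` with `a/s + bs = u² + 2√(ab)` (`sqSubst_sq`, `hasDerivAt_sqSubst`, explicit inverse
  from the quadratic formula): `(√b/2) J_{1/2} + (√a/2) J_{3/2} = √π e^{-2√(ab)}` (Gaussian integral);
* `lintegral_rpow_neg_three_halves_exp` — hence **`J_{3/2} = √(π/a) e^{-2√(ab)}`**;
* `lintegral_Ioi_exp_neg_mul_heatKernel`, `integral_Ioi_exp_neg_mul_heatKernel` —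
  **`∫₀^∞ e^{-μs} G_s(z) ds = e^{-√μ|z|}/(4π|z|)`** for `z ≠ 0`, `μ > 0`, with integrability
  (`a = |z|²/4`, `b = μ`; `exp_neg_mul_heatKernel_eq`, `yukawa_constants`).

* `yukawaEnergy_nonneg`, `coulombMinusYukawaEnergy_nonneg` — with
  `Coulomb.subordinatedEnergy_nonneg` (`CoulombEnergyPositivity.lean`, weights `e^{-ν²s}`,
  `1 - e^{-ν²s}`): **the Yukawa kernel `e^{-ν|x|}/(4π|x|)` and its Coulomb complement
  `(1 - e^{-ν|x|})/(4π|x|)` are positive definite** on `L¹` densities with finite absolute Coulomb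
  energy (`ν > 0`) — the positivity behind the Yukawa cut-offs of [LiebSolovej2001, §3–4].

## References

* [LiebSolovej2001] E. H. Lieb, J. P. Solovej, Commun. Math. Phys. 217 (2001) 127–163, §3
  (Yukawa potentials `Y_ν`, Lemma 3.1) and §4 (cut-offs).
* [LiebLoss2001] E. H. Lieb, M. Loss, *Analysis*, 2nd ed. (2001), Thm. 6.23 (Yukawa potential as
  the kernel of `(-Δ + μ²)⁻¹`), Thm. 9.8.
-/

noncomputable section

open MeasureTheory Set Filter Real
open scoped ENNReal NNReal Topology
open Literature.Analysis.UnboundedOperators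

namespace Literature.MathematicalPhysics.QuantumManyBody.Coulomb

open BoseGas

/-! ### The classical integral `∫₀^∞ s^{-3/2} e^{-a/s-bs} ds = √(π/a) e^{-2√(ab)}` in `ℝ≥0∞` -/

/-- Completing the square: `a/s + bs = (√(bs) - √(a/s))² + 2√(ab)` for `s > 0`, `a, b ≥ 0`.
[folklore] -/
theorem inv_add_lin_eq_sq {a b s : ℝ} (ha : 0 ≤ a) (hb : 0 ≤ b) (hs : 0 < s) :
    a / s + b * s = (Real.sqrt (b * s) - Real.sqrt (a / s)) ^ 2 + 2 * Real.sqrt (a * b) := by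
  have h1 : Real.sqrt (b * s) ^ 2 = b * s := Real.sq_sqrt (by positivity)
  have h2 : Real.sqrt (a / s) ^ 2 = a / s := Real.sq_sqrt (by positivity)
  have h3 : Real.sqrt (b * s) * Real.sqrt (a / s) = Real.sqrt (a * b) := by
    rw [← Real.sqrt_mul (by positivity)]
    congr 1
    field_simp
  nlinarith [h1, h2, h3]

/-- **Inversion symmetry.** For `a, b > 0`, with `c = a/b`, the substitution `s = c/t` gives
`∫₀^∞ s^{-3/2} e^{-a/s-bs} ds = √(b/a) ∫₀^∞ t^{-1/2} e^{-a/t-bt} dt` (in `ℝ≥0∞`). [folklore] -/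
theorem lintegral_rpow_neg_three_halves_exp_eq {a b : ℝ} (ha : 0 < a) (hb : 0 < b) :
    ∫⁻ s in Ioi (0 : ℝ), ENNReal.ofReal (s ^ (-(3 / 2 : ℝ)) * Real.exp (-(a / s + b * s))) =
      ENNReal.ofReal (Real.sqrt (b / a)) *
        ∫⁻ t in Ioi (0 : ℝ), ENNReal.ofReal (t ^ (-(1 / 2 : ℝ)) * Real.exp (-(a / t + b * t))) := by
  set c : ℝ := a / b with hc
  have hc0 : 0 < c := div_pos ha hb
  -- the substitution map `t ↦ c/t` on `(0, ∞)`
  have hderiv : ∀ t ∈ Ioi (0 : ℝ), HasDerivWithinAt (fun t : ℝ => c / t) (-c / t ^ 2) (Ioi 0) t := by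
    intro t ht
    have ht0 : (t : ℝ) ≠ 0 := (ne_of_gt ht)
    have h := (hasDerivAt_inv ht0).const_mul c
    refine (h.hasDerivWithinAt).congr_deriv ?_ |>.congr (fun y _ => by simp [div_eq_mul_inv])
      (by simp [div_eq_mul_inv])
    field_simp
  have hinj : InjOn (fun t : ℝ => c / t) (Ioi 0) := by
    intro x hx y hy hxy
    have hx0 : (x : ℝ) ≠ 0 := ne_of_gt hx
    have hy0 : (y : ℝ) ≠ 0 := ne_of_gt hy
    simp only at hxy
    field_simp at hxy
    nlinarith [hxy, hc0]
  have himage : (fun t : ℝ => c / t) '' Ioi 0 = Ioi 0 := by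
    apply Subset.antisymm
    · rintro _ ⟨t, ht, rfl⟩
      exact div_pos hc0 ht
    · intro y hy
      exact ⟨c / y, div_pos hc0 hy, by simp only; field_simp⟩
  conv_lhs => rw [← himage]
  rw [lintegral_image_eq_lintegral_abs_deriv_mul measurableSet_Ioi hderiv hinj,
    ← lintegral_const_mul' _ _ ENNReal.ofReal_ne_top]
  refine setLIntegral_congr_fun (measurableSet_Ioi : MeasurableSet (Ioi (0 : ℝ))) fun t ht => ?_
  have ht0 : (0 : ℝ) < t := ht
  rw [← ENNReal.ofReal_mul (abs_nonneg _), ← ENNReal.ofReal_mul (Real.sqrt_nonneg _)]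
  congr 1
  -- `|−c/t²| · (c/t)^{-3/2} e^{-q(c/t)} = √(b/a) t^{-1/2} e^{-q(t)}`
  have hq : a / (c / t) + b * (c / t) = a / t + b * t := by
    rw [hc]; field_simp; ring
  rw [hq, abs_div, abs_neg, abs_of_pos hc0, abs_of_pos (by positivity : (0:ℝ) < t ^ 2)]
  have e1 : (c / t) ^ (-(3 / 2 : ℝ)) = c ^ (-(3 / 2 : ℝ)) * t ^ (3 / 2 : ℝ) := by
    rw [Real.div_rpow hc0.le ht0.le, Real.rpow_neg ht0.le, div_eq_mul_inv, inv_inv]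
  have e2 : Real.sqrt (b / a) = c ^ (-(1 / 2 : ℝ)) := by
    rw [hc, Real.sqrt_eq_rpow, Real.rpow_neg (div_pos ha hb).le, ← Real.inv_rpow (div_pos ha hb).le,
      inv_div]
  have e3 : c / t ^ 2 * (c ^ (-(3 / 2 : ℝ)) * t ^ (3 / 2 : ℝ)) = c ^ (-(1 / 2 : ℝ)) * t ^ (-(1 / 2 : ℝ)) := by
    have hc1 : c = c ^ (1 : ℝ) := (Real.rpow_one c).symm
    have : c / t ^ 2 * (c ^ (-(3 / 2 : ℝ)) * t ^ (3 / 2 : ℝ)) =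
        (c ^ (1 : ℝ) * c ^ (-(3 / 2 : ℝ))) * (t ^ (3 / 2 : ℝ) * (t ^ 2)⁻¹) := by
      rw [← hc1]; ring
    rw [this, ← Real.rpow_add hc0, show (t ^ 2)⁻¹ = t ^ (-2 : ℝ) by
        rw [Real.rpow_neg ht0.le, show (2 : ℝ) = ((2 : ℕ) : ℝ) by norm_num, Real.rpow_natCast],
      ← Real.rpow_add ht0]
    norm_num
  rw [e1, e2]
  calc c / t ^ 2 * (c ^ (-(3 / 2 : ℝ)) * t ^ (3 / 2 : ℝ) * Real.exp (-(a / t + b * t)))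
      = (c / t ^ 2 * (c ^ (-(3 / 2 : ℝ)) * t ^ (3 / 2 : ℝ))) * Real.exp (-(a / t + b * t)) := by ring
    _ = c ^ (-(1 / 2 : ℝ)) * t ^ (-(1 / 2 : ℝ)) * Real.exp (-(a / t + b * t)) := by rw [e3]
    _ = c ^ (-(1 / 2 : ℝ)) * (t ^ (-(1 / 2 : ℝ)) * Real.exp (-(a / t + b * t))) := by ring

/-- The substitution map of the completed square, `φ(s) = √b √s − √a/√s`, satisfies
`φ(s)² + 2√(ab) = a/s + bs` (`s > 0`). [folklore] -/
theorem sqSubst_sq {a b s : ℝ} (ha : 0 ≤ a) (hb : 0 ≤ b) (hs : 0 < s) :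
    (Real.sqrt b * Real.sqrt s - Real.sqrt a * (Real.sqrt s)⁻¹) ^ 2 + 2 * Real.sqrt (a * b) =
      a / s + b * s := by
  have hs0 : 0 < Real.sqrt s := Real.sqrt_pos.2 hs
  have h1 : Real.sqrt s ^ 2 = s := Real.sq_sqrt hs.le
  have h2 : Real.sqrt a ^ 2 = a := Real.sq_sqrt ha
  have h3 : Real.sqrt b ^ 2 = b := Real.sq_sqrt hb
  have h4 : Real.sqrt (a * b) = Real.sqrt a * Real.sqrt b := Real.sqrt_mul ha b
  have hti : Real.sqrt s * (Real.sqrt s)⁻¹ = 1 := mul_inv_cancel₀ hs0.ne'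
  have hs' : a / s + b * s = a * ((Real.sqrt s)⁻¹) ^ 2 + b * Real.sqrt s ^ 2 := by
    rw [h1, inv_pow, h1]
    field_simp
  rw [h4, hs']
  linear_combination (Real.sqrt s ^ 2) * h3 + ((Real.sqrt s)⁻¹ ^ 2) * h2 -
    (2 * Real.sqrt a * Real.sqrt b) * hti

/-- The derivative of `φ(s) = √b √s − √a/√s`: `φ'(s) = (√b/2) s^{-1/2} + (√a/2) s^{-3/2}` (`s > 0`).
[folklore] -/
theorem hasDerivAt_sqSubst {a b s : ℝ} (hs : 0 < s) :
    HasDerivAt (fun s : ℝ => Real.sqrt b * Real.sqrt s - Real.sqrt a * (Real.sqrt s)⁻¹)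
      (Real.sqrt b / 2 * s ^ (-(1 / 2 : ℝ)) + Real.sqrt a / 2 * s ^ (-(3 / 2 : ℝ))) s := by
  have hs0 : 0 < Real.sqrt s := Real.sqrt_pos.2 hs
  have h1 : HasDerivAt (fun s : ℝ => Real.sqrt s) (1 / (2 * Real.sqrt s)) s :=
    Real.hasDerivAt_sqrt hs.ne'
  have h2 : HasDerivAt (fun s : ℝ => (Real.sqrt s)⁻¹) (-(1 / (2 * Real.sqrt s)) / Real.sqrt s ^ 2) s :=
    h1.inv hs0.ne'
  have h := (h1.const_mul (Real.sqrt b)).sub (h2.const_mul (Real.sqrt a))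
  refine h.congr_deriv ?_
  -- rewrite the powers: `s^{-1/2} = (√s)⁻¹`, `s^{-3/2} = (√s)⁻¹/s`
  have e1 : s ^ (-(1 / 2 : ℝ)) = (Real.sqrt s)⁻¹ := by
    rw [Real.rpow_neg hs.le, ← Real.sqrt_eq_rpow]
  have e2 : s ^ (-(3 / 2 : ℝ)) = (Real.sqrt s)⁻¹ / s := by
    rw [Real.rpow_neg hs.le, show (3 / 2 : ℝ) = 1 + 1 / 2 by norm_num, Real.rpow_add hs,
      Real.rpow_one, ← Real.sqrt_eq_rpow]
    field_simp
  have hss : Real.sqrt s ^ 2 = s := Real.sq_sqrt hs.le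
  rw [e1, e2, hss]
  field_simp
  ring

/-- **The completed-square substitution.** For `a, b > 0`,
`∫₀^∞ ((√b/2) s^{-1/2} + (√a/2) s^{-3/2}) e^{-a/s-bs} ds = √π e^{-2√(ab)}` (in `ℝ≥0∞`):
`u = √(bs) − √(a/s)` maps `(0,∞)` onto `ℝ` and `a/s + bs = u² + 2√(ab)`. [folklore] -/
theorem lintegral_sqSubst_gaussian {a b : ℝ} (ha : 0 < a) (hb : 0 < b) :
    ∫⁻ s in Ioi (0 : ℝ), ENNReal.ofReal ((Real.sqrt b / 2 * s ^ (-(1 / 2 : ℝ)) +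
        Real.sqrt a / 2 * s ^ (-(3 / 2 : ℝ))) * Real.exp (-(a / s + b * s))) =
      ENNReal.ofReal (Real.sqrt π * Real.exp (-(2 * Real.sqrt (a * b)))) := by
  set φ : ℝ → ℝ := fun s => Real.sqrt b * Real.sqrt s - Real.sqrt a * (Real.sqrt s)⁻¹ with hφ
  set φ' : ℝ → ℝ := fun s => Real.sqrt b / 2 * s ^ (-(1 / 2 : ℝ)) + Real.sqrt a / 2 * s ^ (-(3 / 2 : ℝ))
    with hφ'
  have hsa : 0 < Real.sqrt a := Real.sqrt_pos.2 ha
  have hsb : 0 < Real.sqrt b := Real.sqrt_pos.2 hb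
  have hφ'pos : ∀ s : ℝ, 0 < s → 0 < φ' s := fun s hs => by
    simp only [hφ']
    have := Real.rpow_pos_of_pos hs (-(1 / 2 : ℝ))
    have := Real.rpow_pos_of_pos hs (-(3 / 2 : ℝ))
    positivity
  have hderiv : ∀ s ∈ Ioi (0 : ℝ), HasDerivWithinAt φ (φ' s) (Ioi 0) s := fun s hs =>
    (hasDerivAt_sqSubst hs).hasDerivWithinAt
  -- strict monotonicity, hence injectivity
  have hmono : StrictMonoOn φ (Ioi (0 : ℝ)) := by
    intro x hx y hy hxy
    have hx0 : (0:ℝ) < x := hx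
    have hy0 : (0:ℝ) < y := hy
    have h1 : Real.sqrt x < Real.sqrt y := Real.sqrt_lt_sqrt hx0.le hxy
    have hxpos : 0 < Real.sqrt x := Real.sqrt_pos.2 hx0
    have h2 : (Real.sqrt y)⁻¹ < (Real.sqrt x)⁻¹ := by
      rw [inv_lt_inv₀ (Real.sqrt_pos.2 hy0) hxpos]; exact h1
    simp only [hφ]
    nlinarith [mul_lt_mul_of_pos_left h1 hsb, mul_lt_mul_of_pos_left h2 hsa]
  -- surjectivity onto `ℝ` (explicit inverse from the quadratic formula)
  have himage : φ '' Ioi 0 = univ := by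
    refine eq_univ_of_forall fun u => ?_
    set D : ℝ := Real.sqrt (u ^ 2 + 4 * (Real.sqrt a * Real.sqrt b)) with hD
    have hD2 : D ^ 2 = u ^ 2 + 4 * (Real.sqrt a * Real.sqrt b) := Real.sq_sqrt (by positivity)
    have hDu : |u| < D := by
      rw [← Real.sqrt_sq_eq_abs]
      exact Real.sqrt_lt_sqrt (sq_nonneg _) (by nlinarith [mul_pos hsa hsb])
    have hDu' : 0 < u + D := by
      have := neg_abs_le u
      linarith
    set y : ℝ := (u + D) / (2 * Real.sqrt b) with hy
    have hy0 : 0 < y := by rw [hy]; positivity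
    have hquad : Real.sqrt b * y ^ 2 - u * y - Real.sqrt a = 0 := by
      rw [hy]
      field_simp
      nlinarith [hD2]
    refine ⟨y ^ 2, mem_Ioi.2 (pow_pos hy0 2), ?_⟩
    simp only [hφ]
    rw [Real.sqrt_sq hy0.le]
    field_simp
    nlinarith [hquad]
  -- change of variables
  have hgi : Integrable fun u : ℝ => Real.exp (-1 * u ^ 2) := integrable_exp_neg_mul_sq one_pos
  have hval : ∫⁻ u : ℝ, ENNReal.ofReal (Real.exp (-1 * u ^ 2)) = ENNReal.ofReal (Real.sqrt π) := by
    rw [← ofReal_integral_eq_lintegral_ofReal hgi (Eventually.of_forall fun u => (Real.exp_pos _).le),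
      integral_gaussian, div_one]
  calc ∫⁻ s in Ioi (0 : ℝ), ENNReal.ofReal ((Real.sqrt b / 2 * s ^ (-(1 / 2 : ℝ)) +
          Real.sqrt a / 2 * s ^ (-(3 / 2 : ℝ))) * Real.exp (-(a / s + b * s)))
      = ∫⁻ s in Ioi (0 : ℝ), ENNReal.ofReal |φ' s| *
          ENNReal.ofReal (Real.exp (-1 * φ s ^ 2) * Real.exp (-(2 * Real.sqrt (a * b)))) := by
        refine setLIntegral_congr_fun measurableSet_Ioi fun s hs => ?_
        have hs0 : (0:ℝ) < s := hs
        have hq : -(a / s + b * s) = -1 * φ s ^ 2 + -(2 * Real.sqrt (a * b)) := by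
          have := sqSubst_sq ha.le hb.le hs0
          simp only [hφ]
          linarith
        rw [abs_of_pos (hφ'pos s hs0), ← ENNReal.ofReal_mul (hφ'pos s hs0).le, ← Real.exp_add, hq]
    _ = ∫⁻ u in φ '' Ioi 0, ENNReal.ofReal (Real.exp (-1 * u ^ 2) * Real.exp (-(2 * Real.sqrt (a * b)))) :=
        (lintegral_image_eq_lintegral_abs_deriv_mul measurableSet_Ioi hderiv hmono.injOn
          (fun u => ENNReal.ofReal (Real.exp (-1 * u ^ 2) * Real.exp (-(2 * Real.sqrt (a * b)))))).symm
    _ = ENNReal.ofReal (Real.sqrt π * Real.exp (-(2 * Real.sqrt (a * b)))) := by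
        rw [himage, Measure.restrict_univ]
        have e : ∀ u : ℝ, ENNReal.ofReal (Real.exp (-1 * u ^ 2) * Real.exp (-(2 * Real.sqrt (a * b)))) =
            ENNReal.ofReal (Real.exp (-1 * u ^ 2)) * ENNReal.ofReal (Real.exp (-(2 * Real.sqrt (a * b)))) :=
          fun u => ENNReal.ofReal_mul (Real.exp_pos _).le
        simp_rw [e]
        rw [lintegral_mul_const _ (by fun_prop), hval, ← ENNReal.ofReal_mul (Real.sqrt_nonneg _)]

/-- **`∫₀^∞ s^{-3/2} e^{-a/s-bs} ds = √(π/a) e^{-2√(ab)}`** for `a, b > 0`, in `ℝ≥0∞`: from the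
inversion symmetry `J_{3/2} = √(b/a) J_{1/2}` and the completed-square substitution
`(√b/2) J_{1/2} + (√a/2) J_{3/2} = √π e^{-2√(ab)}`. [folklore] -/
theorem lintegral_rpow_neg_three_halves_exp {a b : ℝ} (ha : 0 < a) (hb : 0 < b) :
    ∫⁻ s in Ioi (0 : ℝ), ENNReal.ofReal (s ^ (-(3 / 2 : ℝ)) * Real.exp (-(a / s + b * s))) =
      ENNReal.ofReal (Real.sqrt (π / a) * Real.exp (-(2 * Real.sqrt (a * b)))) := by
  set J₁ : ℝ≥0∞ := ∫⁻ s in Ioi (0 : ℝ), ENNReal.ofReal (s ^ (-(3 / 2 : ℝ)) * Real.exp (-(a / s + b * s)))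
    with hJ₁
  set J₂ : ℝ≥0∞ := ∫⁻ s in Ioi (0 : ℝ), ENNReal.ofReal (s ^ (-(1 / 2 : ℝ)) * Real.exp (-(a / s + b * s)))
    with hJ₂
  have hsa : 0 < Real.sqrt a := Real.sqrt_pos.2 ha
  have hsb : 0 < Real.sqrt b := Real.sqrt_pos.2 hb
  have h1 : J₁ = ENNReal.ofReal (Real.sqrt (b / a)) * J₂ := lintegral_rpow_neg_three_halves_exp_eq ha hb
  have h2 := lintegral_sqSubst_gaussian ha hb
  -- split the left side of `h2` into `(√b/2) J₂ + (√a/2) J₁`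
  have hsplit : ∫⁻ s in Ioi (0 : ℝ), ENNReal.ofReal ((Real.sqrt b / 2 * s ^ (-(1 / 2 : ℝ)) +
      Real.sqrt a / 2 * s ^ (-(3 / 2 : ℝ))) * Real.exp (-(a / s + b * s))) =
      ENNReal.ofReal (Real.sqrt b / 2) * J₂ + ENNReal.ofReal (Real.sqrt a / 2) * J₁ := by
    have e : ∀ s ∈ Ioi (0 : ℝ), ENNReal.ofReal ((Real.sqrt b / 2 * s ^ (-(1 / 2 : ℝ)) +
        Real.sqrt a / 2 * s ^ (-(3 / 2 : ℝ))) * Real.exp (-(a / s + b * s))) =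
        ENNReal.ofReal (Real.sqrt b / 2) * ENNReal.ofReal (s ^ (-(1 / 2 : ℝ)) * Real.exp (-(a / s + b * s))) +
          ENNReal.ofReal (Real.sqrt a / 2) * ENNReal.ofReal (s ^ (-(3 / 2 : ℝ)) * Real.exp (-(a / s + b * s))) := by
      intro s hs
      have hs0 : (0:ℝ) < s := hs
      have p1 : 0 ≤ s ^ (-(1 / 2 : ℝ)) * Real.exp (-(a / s + b * s)) := by positivity
      have p2 : 0 ≤ s ^ (-(3 / 2 : ℝ)) * Real.exp (-(a / s + b * s)) := by positivity
      rw [add_mul, ENNReal.ofReal_add (by positivity) (by positivity), mul_assoc, mul_assoc,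
        ENNReal.ofReal_mul (p := Real.sqrt b / 2) (by positivity),
        ENNReal.ofReal_mul (p := Real.sqrt a / 2) (by positivity)]
    rw [setLIntegral_congr_fun measurableSet_Ioi e, lintegral_add_left ((by fun_prop : Measurable fun s : ℝ =>
        ENNReal.ofReal (s ^ (-(1 / 2 : ℝ)) * Real.exp (-(a / s + b * s)))).const_mul _),
      lintegral_const_mul' _ _ ENNReal.ofReal_ne_top, lintegral_const_mul' _ _ ENNReal.ofReal_ne_top]
  rw [hsplit] at h2
  -- finiteness
  have hJ₁top : J₁ ≠ ⊤ := by
    intro htop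
    have : ENNReal.ofReal (Real.sqrt a / 2) * J₁ = ⊤ := by
      rw [htop, ENNReal.mul_top (by exact (ENNReal.ofReal_pos.2 (by positivity)).ne')]
    rw [this, add_top] at h2
    exact ENNReal.ofReal_ne_top h2.symm
  have hJ₂top : J₂ ≠ ⊤ := by
    intro htop
    have : ENNReal.ofReal (Real.sqrt b / 2) * J₂ = ⊤ := by
      rw [htop, ENNReal.mul_top (by exact (ENNReal.ofReal_pos.2 (by positivity)).ne')]
    rw [this, top_add] at h2
    exact ENNReal.ofReal_ne_top h2.symm
  -- pass to reals
  set j₁ : ℝ := J₁.toReal with hj₁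
  set j₂ : ℝ := J₂.toReal with hj₂
  have hj₁0 : 0 ≤ j₁ := ENNReal.toReal_nonneg
  have hj₂0 : 0 ≤ j₂ := ENNReal.toReal_nonneg
  have r1 : j₁ = Real.sqrt (b / a) * j₂ := by
    have := congrArg ENNReal.toReal h1
    rwa [ENNReal.toReal_mul, ENNReal.toReal_ofReal (Real.sqrt_nonneg _)] at this
  have r2 : Real.sqrt b / 2 * j₂ + Real.sqrt a / 2 * j₁ = Real.sqrt π * Real.exp (-(2 * Real.sqrt (a * b))) := by
    have := congrArg ENNReal.toReal h2
    rwa [ENNReal.toReal_add (ENNReal.mul_ne_top ENNReal.ofReal_ne_top hJ₂top)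
      (ENNReal.mul_ne_top ENNReal.ofReal_ne_top hJ₁top), ENNReal.toReal_mul, ENNReal.toReal_mul,
      ENNReal.toReal_ofReal (by positivity), ENNReal.toReal_ofReal (by positivity),
      ENNReal.toReal_ofReal (by positivity)] at this
  -- solve: `√b √(b/a)⁻¹... `; use `√(b/a) = √b/√a`, `√(π/a) = √π/√a`
  have e1 : Real.sqrt (b / a) = Real.sqrt b / Real.sqrt a := Real.sqrt_div' b ha.le
  have e2 : Real.sqrt (π / a) = Real.sqrt π / Real.sqrt a := Real.sqrt_div' π ha.le
  have hj₁val : j₁ = Real.sqrt (π / a) * Real.exp (-(2 * Real.sqrt (a * b))) := by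
    rw [e1] at r1
    rw [e2]
    have hsa2 : Real.sqrt a ^ 2 = a := Real.sq_sqrt ha.le
    field_simp
    field_simp at r1
    nlinarith [r1, r2, hsa, hsb, hsa2]
  calc J₁ = ENNReal.ofReal j₁ := (ENNReal.ofReal_toReal hJ₁top).symm
    _ = _ := by rw [hj₁val]

/-! ### The Yukawa kernel: Laplace transform of the heat kernel of `ℝ³` -/

/-- Pointwise: `e^{-μs} G_s(z) = (4π)^{-3/2} · s^{-3/2} e^{-(a/s + μs)}` with `a = |z|²/4` (`s > 0`).
[folklore] -/
theorem exp_neg_mul_heatKernel_eq {z : Space} {μ s : ℝ} (hs : 0 < s) :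
    Real.exp (-(μ * s)) * heatKernel s z =
      (4 * π) ^ (-(3 / 2 : ℝ)) * (s ^ (-(3 / 2 : ℝ)) * Real.exp (-(‖z‖ ^ 2 / 4 / s + μ * s))) := by
  rw [heatKernel_three, Real.mul_rpow (by positivity) hs.le]
  have : Real.exp (-(μ * s)) * Real.exp (-‖z‖ ^ 2 / (4 * s)) = Real.exp (-(‖z‖ ^ 2 / 4 / s + μ * s)) := by
    rw [← Real.exp_add]
    congr 1
    field_simp
    ring
  calc Real.exp (-(μ * s)) * ((4 * π) ^ (-(3 / 2 : ℝ)) * s ^ (-(3 / 2 : ℝ)) * Real.exp (-‖z‖ ^ 2 / (4 * s)))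
      = (4 * π) ^ (-(3 / 2 : ℝ)) * (s ^ (-(3 / 2 : ℝ)) *
          (Real.exp (-(μ * s)) * Real.exp (-‖z‖ ^ 2 / (4 * s)))) := by ring
    _ = _ := by rw [this]

/-- The constants: `(4π)^{-3/2} · √(π/(|z|²/4)) = (4π|z|)⁻¹` and `2√((|z|²/4) μ) = √μ |z|`. [folklore] -/
theorem yukawa_constants {r μ : ℝ} (hr : 0 < r) (hμ : 0 ≤ μ) :
    (4 * π) ^ (-(3 / 2 : ℝ)) * (Real.sqrt (π / (r ^ 2 / 4)) * Real.exp (-(2 * Real.sqrt (r ^ 2 / 4 * μ)))) =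
      Real.exp (-(Real.sqrt μ * r)) / (4 * π * r) := by
  have hπ : 0 < π := Real.pi_pos
  have e1 : Real.sqrt (π / (r ^ 2 / 4)) = 2 * Real.sqrt π / r := by
    rw [show π / (r ^ 2 / 4) = (2 / r) ^ 2 * π by field_simp; ring, Real.sqrt_mul' _ hπ.le,
      Real.sqrt_sq (by positivity)]
    ring
  have e2 : Real.sqrt (r ^ 2 / 4 * μ) = r / 2 * Real.sqrt μ := by
    rw [show r ^ 2 / 4 * μ = (r / 2) ^ 2 * μ by ring, Real.sqrt_mul' _ hμ, Real.sqrt_sq (by positivity)]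
  have e3 : (4 * π) ^ (-(3 / 2 : ℝ)) = (4 * π * (2 * Real.sqrt π))⁻¹ := by
    rw [Real.rpow_neg (by positivity), show (3 / 2 : ℝ) = 1 + 1 / 2 by norm_num,
      Real.rpow_add (by positivity), Real.rpow_one, ← Real.sqrt_eq_rpow, Real.sqrt_mul' _ hπ.le,
      show Real.sqrt 4 = 2 by rw [show (4:ℝ) = 2 ^ 2 by norm_num, Real.sqrt_sq (by norm_num)]]
  have hsπ : 0 < Real.sqrt π := Real.sqrt_pos.2 hπ
  rw [e1, e2, e3, show 2 * (r / 2 * Real.sqrt μ) = Real.sqrt μ * r by ring]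
  field_simp

/-- **The Yukawa (resolvent) kernel by subordination**, `ℝ≥0∞` form: for `z ≠ 0` and `μ > 0`,
`∫⁻₀^∞ e^{-μs} G_s(z) ds = e^{-√μ|z|}/(4π|z|)` — the kernel of `(-Δ + μ)⁻¹` on `ℝ³` as the Laplace
transform of the heat kernel (the case `μ = 0` is `BoseGas.integral_Ioi_heatKernel`). [folklore] -/
theorem lintegral_Ioi_exp_neg_mul_heatKernel {z : Space} (hz : z ≠ 0) {μ : ℝ} (hμ : 0 < μ) :
    ∫⁻ s in Ioi (0 : ℝ), ENNReal.ofReal (Real.exp (-(μ * s)) * heatKernel s z) =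
      ENNReal.ofReal (Real.exp (-(Real.sqrt μ * ‖z‖)) / (4 * π * ‖z‖)) := by
  have hr : 0 < ‖z‖ := norm_pos_iff.2 hz
  have ha : 0 < ‖z‖ ^ 2 / 4 := by positivity
  have e : ∀ s ∈ Ioi (0 : ℝ), ENNReal.ofReal (Real.exp (-(μ * s)) * heatKernel s z) =
      ENNReal.ofReal ((4 * π) ^ (-(3 / 2 : ℝ))) *
        ENNReal.ofReal (s ^ (-(3 / 2 : ℝ)) * Real.exp (-(‖z‖ ^ 2 / 4 / s + μ * s))) := by
    intro s hs
    rw [exp_neg_mul_heatKernel_eq (show (0:ℝ) < s from hs), ENNReal.ofReal_mul (by positivity)]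
  rw [setLIntegral_congr_fun measurableSet_Ioi e, lintegral_const_mul' _ _ ENNReal.ofReal_ne_top,
    lintegral_rpow_neg_three_halves_exp ha hμ, ← ENNReal.ofReal_mul (by positivity),
    yukawa_constants hr hμ.le]

/-- **The Yukawa (resolvent) kernel by subordination**: for `z ≠ 0` and `μ > 0`,
`s ↦ e^{-μs} G_s(z)` is integrable on `(0, ∞)` and `∫₀^∞ e^{-μs} G_s(z) ds = e^{-√μ|z|}/(4π|z|)`.
[folklore] -/
theorem integral_Ioi_exp_neg_mul_heatKernel {z : Space} (hz : z ≠ 0) {μ : ℝ} (hμ : 0 < μ) :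
    IntegrableOn (fun s : ℝ => Real.exp (-(μ * s)) * heatKernel s z) (Ioi 0) ∧
      ∫ s in Ioi (0 : ℝ), Real.exp (-(μ * s)) * heatKernel s z =
        Real.exp (-(Real.sqrt μ * ‖z‖)) / (4 * π * ‖z‖) := by
  have hL := lintegral_Ioi_exp_neg_mul_heatKernel hz hμ
  have h0 : 0 ≤ᵐ[volume.restrict (Ioi (0 : ℝ))] fun s : ℝ => Real.exp (-(μ * s)) * heatKernel s z := by
    refine (ae_restrict_iff' measurableSet_Ioi).2 (Eventually.of_forall fun s hs => ?_)
    exact mul_nonneg (Real.exp_pos _).le (heatKernel_pos (show (0:ℝ) < s from hs) z).le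
  have hm : AEStronglyMeasurable (fun s : ℝ => Real.exp (-(μ * s)) * heatKernel s z)
      (volume.restrict (Ioi (0 : ℝ))) := by
    have : Measurable fun s : ℝ => Real.exp (-(μ * s)) * heatKernel s z :=
      (by fun_prop : Measurable fun s : ℝ => Real.exp (-(μ * s))).mul
        (measurable_heatKernel_uncurry.comp (measurable_id.prodMk measurable_const))
    exact this.aestronglyMeasurable
  have hV : 0 ≤ Real.exp (-(Real.sqrt μ * ‖z‖)) / (4 * π * ‖z‖) := by
    have := norm_pos_iff.2 hz
    positivity
  refine ⟨(lintegral_ofReal_ne_top_iff_integrable hm h0).1 (by rw [hL]; exact ENNReal.ofReal_ne_top), ?_⟩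
  rw [integral_eq_lintegral_of_nonneg_ae h0 hm, hL, ENNReal.toReal_ofReal hV]

/-! ### Positive definiteness of the Yukawa kernel and of its Coulomb complement -/

/-- **The Yukawa potential is positive definite** on `ℝ³`: for `ν > 0` and a real measurable
`f ∈ L¹(ℝ³)` with finite absolute Coulomb energy,
`0 ≤ ∬ f(x) f(y) e^{-ν|x-y|}/(4π|x-y|) d(x, y)` (and the integrand is absolutely integrable) —
subordination with weight `w(s) = e^{-ν²s} ∈ [0, 1]` (`Coulomb.subordinatedEnergy_nonneg`) and the
kernel identity `∫₀^∞ e^{-ν²s} G_s = e^{-ν|·|}/(4π|·|)`. (Fourier side: `4π/(k² + ν²) ≥ 0`.)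
[cite: LiebLoss2001, Thm. 9.8] -/
theorem yukawaEnergy_nonneg {ν : ℝ} (hν : 0 < ν) {f : Space → ℝ} (hfm : Measurable f)
    (hf : Integrable f)
    (hfin : Integrable (fun z : Space × Space => f z.1 * f z.2 * (4 * π * ‖z.1 - z.2‖)⁻¹)
      (volume.prod volume)) :
    Integrable (fun z : Space × Space =>
        f z.1 * f z.2 * (Real.exp (-(ν * ‖z.1 - z.2‖)) / (4 * π * ‖z.1 - z.2‖))) (volume.prod volume) ∧
      0 ≤ ∫ z : Space × Space, f z.1 * f z.2 * (Real.exp (-(ν * ‖z.1 - z.2‖)) / (4 * π * ‖z.1 - z.2‖))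
        ∂(volume.prod volume) := by
  set μ : ℝ := ν ^ 2 with hμ
  have hμ0 : 0 < μ := by positivity
  have hsq : Real.sqrt μ = ν := by rw [hμ, Real.sqrt_sq hν.le]
  have hwm : Measurable fun s : ℝ => Real.exp (-(μ * s)) := by fun_prop
  have hw0 : ∀ s : ℝ, 0 < s → 0 ≤ Real.exp (-(μ * s)) := fun s _ => (Real.exp_pos _).le
  have hw1 : ∀ s : ℝ, 0 < s → Real.exp (-(μ * s)) ≤ 1 := fun s hs =>
    Real.exp_le_one_iff.2 (by nlinarith [hμ0, hs])
  obtain ⟨hint, hpos⟩ := subordinatedEnergy_nonneg hwm hw0 hw1 hfm hf hfin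
  have hae : (fun z : Space × Space =>
      f z.1 * f z.2 * (∫ s in Ioi (0 : ℝ), Real.exp (-(μ * s)) * heatKernel s (z.1 - z.2))) =ᵐ[volume.prod volume]
      fun z => f z.1 * f z.2 * (Real.exp (-(ν * ‖z.1 - z.2‖)) / (4 * π * ‖z.1 - z.2‖)) := by
    filter_upwards [ae_fst_ne_snd] with z hz
    rw [(integral_Ioi_exp_neg_mul_heatKernel (sub_ne_zero.2 hz) hμ0).2, hsq]
  exact ⟨hint.congr hae, (integral_congr_ae hae) ▸ hpos⟩

/-- **The Coulomb kernel dominates the Yukawa kernel in the sense of forms**: for `ν > 0` and a real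
measurable `f ∈ L¹(ℝ³)` with finite absolute Coulomb energy,
`0 ≤ ∬ f(x) f(y) (1 - e^{-ν|x-y|})/(4π|x-y|) d(x, y)`, i.e. `D_{Yukawa}(f,f) ≤ D(f,f)` —
subordination with weight `w(s) = 1 - e^{-ν²s} ∈ [0, 1]`. (Fourier side:
`4π/k² - 4π/(k²+ν²) ≥ 0`; this is the positivity behind the long/short-distance Yukawa cut-offs of
the Coulomb potential in [LiebSolovej2001, §3–4].) [cite: LiebLoss2001, Thm. 9.8] -/
theorem coulombMinusYukawaEnergy_nonneg {ν : ℝ} (hν : 0 < ν) {f : Space → ℝ} (hfm : Measurable f)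
    (hf : Integrable f)
    (hfin : Integrable (fun z : Space × Space => f z.1 * f z.2 * (4 * π * ‖z.1 - z.2‖)⁻¹)
      (volume.prod volume)) :
    Integrable (fun z : Space × Space =>
        f z.1 * f z.2 * ((1 - Real.exp (-(ν * ‖z.1 - z.2‖))) / (4 * π * ‖z.1 - z.2‖)))
        (volume.prod volume) ∧
      0 ≤ ∫ z : Space × Space,
        f z.1 * f z.2 * ((1 - Real.exp (-(ν * ‖z.1 - z.2‖))) / (4 * π * ‖z.1 - z.2‖))
          ∂(volume.prod volume) := by
  set μ : ℝ := ν ^ 2 with hμ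
  have hμ0 : 0 < μ := by positivity
  have hsq : Real.sqrt μ = ν := by rw [hμ, Real.sqrt_sq hν.le]
  have hwm : Measurable fun s : ℝ => 1 - Real.exp (-(μ * s)) := by fun_prop
  have hw0 : ∀ s : ℝ, 0 < s → 0 ≤ 1 - Real.exp (-(μ * s)) := fun s hs =>
    sub_nonneg.2 (Real.exp_le_one_iff.2 (by nlinarith [hμ0, hs]))
  have hw1 : ∀ s : ℝ, 0 < s → 1 - Real.exp (-(μ * s)) ≤ 1 := fun s _ =>
    sub_le_self _ (Real.exp_pos _).le
  obtain ⟨hint, hpos⟩ := subordinatedEnergy_nonneg hwm hw0 hw1 hfm hf hfin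
  have hker : ∀ z : Space × Space, z.1 ≠ z.2 →
      ∫ s in Ioi (0 : ℝ), (1 - Real.exp (-(μ * s))) * heatKernel s (z.1 - z.2) =
        (1 - Real.exp (-(ν * ‖z.1 - z.2‖))) / (4 * π * ‖z.1 - z.2‖) := by
    intro z hz
    have hw : z.1 - z.2 ≠ 0 := sub_ne_zero.2 hz
    obtain ⟨hYi, hYv⟩ := integral_Ioi_exp_neg_mul_heatKernel hw hμ0
    have hGi := integrableOn_Ioi_heatKernel hw
    have e : ∀ s : ℝ, (1 - Real.exp (-(μ * s))) * heatKernel s (z.1 - z.2) =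
        heatKernel s (z.1 - z.2) - Real.exp (-(μ * s)) * heatKernel s (z.1 - z.2) := fun s => by ring
    simp_rw [e]
    rw [integral_sub hGi hYi, integral_Ioi_heatKernel hw, hYv, hsq]
    field_simp
  have hae : (fun z : Space × Space =>
      f z.1 * f z.2 * (∫ s in Ioi (0 : ℝ), (1 - Real.exp (-(μ * s))) * heatKernel s (z.1 - z.2)))
        =ᵐ[volume.prod volume]
      fun z => f z.1 * f z.2 * ((1 - Real.exp (-(ν * ‖z.1 - z.2‖))) / (4 * π * ‖z.1 - z.2‖)) := by
    filter_upwards [ae_fst_ne_snd] with z hz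
    rw [hker z hz]
  exact ⟨hint.congr hae, (integral_congr_ae hae) ▸ hpos⟩

end Literature.MathematicalPhysics.QuantumManyBody.Coulomb
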